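import Summits.AtomisticToContinuum.HydrodynamicLimit.Theorems.InformationPercolationEngineChaosClosesEulerReadoutEvents
import Summits.AtomisticToContinuum.HydrodynamicLimit.Theorems.InformationPercolationEngineChaosClosesEulerReadoutChains
import Summits.AtomisticToContinuum.HydrodynamicLimit.Theorems.OneFlightGossipEngineEquilibriumClampedCollisionalWindowLDKinRecordsC1
import HarnessLib

/-!
# Weak readout at the instant `t` (crux `ChaosClosesEuler`, stmt-AtomisticToContinuum-15141, line `Sketch`,
# stub `stub_readout`) — helper 6: the pathwise step and the union bound

WHAT.

* `readout_pathwise` — along ONE good orbit lying outside the six bad events (energy level `K_E`, time-averaged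
  `L¹(dx)` error `≤ η₁Δ`, windowed cubic tail `≤ κ₁`, quadratic collision tail `≤ η₂`, collision-rate deviation
  `≤ η₃`, density cap at scale `r` on `[0, τ₁]`), with the window `Δ` and the tolerances small in the stated
  product forms, the three `b`-tested empirical fields at the instant `t` are within `κ/2` of `∫ b ρ(t)`,
  `∫ b ρu(t)`, `∫ b E(t)`: the windowed collision functional of helper 5 (`kfac_windowQuad_le`), one good instant
  (`exists_good_instant`), the three chains, and bookkeeping of the tolerances.
* `exists_consts_of_isSmooth` — one constant `L ≥ 1` controlling a smooth test `b` (`sup |b|`, its Lipschitz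
  constant in the minimal-image distance, `sup ‖Db‖`, and the same for the vector tests `b • e_k`);
* `measure_le_of_forall_notMem` — the union bound: an event avoided by every point outside seven events of
  probabilities `≤ δ₈` (six of them) and `0` has probability `≤ 6δ₈ ≤ δ'`.

No named fact is invoked.
-/

noncomputable section

namespace Summit.AtomisticToContinuum.HydrodynamicLimit.Theorems.ChaosClosesEulerReadout

open scoped BigOperators Topology Classical MeasureTheory ENNReal InnerProductSpace
open Filter Set MeasureTheory Function
open Literature.MathematicalPhysics.KineticTheory
open Literature.Analysis.FluidPDE
open Literature.Analysis.FunctionSpaces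
open Summit.AtomisticToContinuum.HydrodynamicLimit.Theorems.DensityCapNegative (cone)

/-- **Registered sub-goal `stub_readoutPathwise` (helper 6 of `stub_readout`).** `√(2x) ≤ 1/2 + x` for `x ≥ 0`:
the quadratic-mean speed `√(2Ē)` of the mean displacement bound is paid by `1/2 + Ē`. [folklore] -/
theorem stub_readoutPathwise : ∀ {x : ℝ}, 0 ≤ x → Real.sqrt (2 * x) ≤ 1 / 2 + x := by
  intro x hx
  exact (Real.sqrt_le_left (by positivity)).2 (by nlinarith [sq_nonneg (x - 1 / 2)])

/-- **The constants of a smooth test.** For `b` smooth on `𝕋³` there is ONE `L ≥ 1` with `|b| ≤ L`,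
`|b x − b y| ≤ L d(x, y)` (minimal-image distance), `‖Db‖ ≤ L`, and, for each Cartesian direction `k`, the vector
test `b • e_k` is `C¹` with `‖D(b • e_k)‖ ≤ L` and `L`-Lipschitz. [folklore] -/
theorem exists_consts_of_isSmooth {b : T3 → ℝ} (hb : Torus.IsSmooth b) :
    ∃ L : ℝ, 1 ≤ L ∧ (∀ x, |b x| ≤ L) ∧ (∀ x y, |b x - b y| ≤ L * Torus.euclidDist x y) ∧
      Torus.IsContDiff 1 b ∧ (∀ x, ‖Torus.fderiv b x‖ ≤ L) ∧
      ∀ k : Fin 3, Torus.IsContDiff 1 (fun x => b x • EuclideanSpace.single k (1 : ℝ)) ∧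
        (∀ x, ‖Torus.fderiv (fun x => b x • EuclideanSpace.single k (1 : ℝ)) x‖ ≤ L) ∧
        (∀ x y, ‖b x • EuclideanSpace.single k (1 : ℝ) - b y • EuclideanSpace.single k (1 : ℝ)‖ ≤
          L * Torus.euclidDist x y) := by
  obtain ⟨Cb, hCb0, hCb⟩ := exists_forall_abs_le_of_continuous hb.continuous
  obtain ⟨Lb, hLb0, hLb⟩ := ClampedTransferCoin.adaptedClampKinematics_lipschitz hb
  have hb1 : Torus.IsContDiff 1 b := hb.isContDiff (by simp)
  obtain ⟨LD, hLD⟩ := isCompact_univ.exists_bound_of_continuousOn (Torus.continuous_fderiv hb1).continuousOn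
  have hJ1 : ∀ k : Fin 3, Torus.IsContDiff 1 (fun x => b x • EuclideanSpace.single k (1 : ℝ)) := fun k => by
    change ContDiff ℝ 1 fun y => Torus.lift b y • EuclideanSpace.single k (1 : ℝ)
    exact ContDiff.smul hb1 contDiff_const
  have hJD : ∀ k : Fin 3, ∃ C, 0 ≤ C ∧ ∀ x, ‖Torus.fderiv (fun x => b x • EuclideanSpace.single k (1 : ℝ)) x‖ ≤ C :=
    fun k => by
      obtain ⟨C, hC⟩ := isCompact_univ.exists_bound_of_continuousOn (Torus.continuous_fderiv (hJ1 k)).continuousOn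
      exact ⟨max C 0, le_max_right _ _, fun x => (hC x (mem_univ x)).trans (le_max_left _ _)⟩
  choose CJ hCJ0 hCJ using hJD
  refine ⟨1 + Cb + Lb + max LD 0 + ∑ k, CJ k, ?_, fun x => ?_, fun x y => ?_, hb1, fun x => ?_, fun k => ⟨hJ1 k, fun x => ?_,
    fun x y => ?_⟩⟩
  · have : 0 ≤ ∑ k, CJ k := Finset.sum_nonneg fun k _ => hCJ0 k
    linarith [le_max_right LD 0]
  · have : 0 ≤ ∑ k, CJ k := Finset.sum_nonneg fun k _ => hCJ0 k
    linarith [hCb x, le_max_right LD 0]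
  · have h0 : 0 ≤ Torus.euclidDist x y := norm_nonneg _
    have : 0 ≤ ∑ k, CJ k := Finset.sum_nonneg fun k _ => hCJ0 k
    calc |b x - b y| ≤ Lb * Torus.euclidDist x y := hLb x y
      _ ≤ _ := by
          refine mul_le_mul_of_nonneg_right ?_ h0
          linarith [le_max_right LD 0]
  · have : 0 ≤ ∑ k, CJ k := Finset.sum_nonneg fun k _ => hCJ0 k
    linarith [hLD x (mem_univ x), le_max_left LD 0]
  · have hk : CJ k ≤ ∑ k, CJ k := Finset.single_le_sum (fun k _ => hCJ0 k) (Finset.mem_univ k)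
    linarith [hCJ k x, le_max_right LD 0]
  · have h0 : 0 ≤ Torus.euclidDist x y := norm_nonneg _
    have : 0 ≤ ∑ k, CJ k := Finset.sum_nonneg fun k _ => hCJ0 k
    have hs : ‖(EuclideanSpace.single k (1 : ℝ) : V3)‖ = 1 := by simp
    rw [← sub_smul, norm_smul, Real.norm_eq_abs, hs, mul_one]
    calc |b x - b y| ≤ Lb * Torus.euclidDist x y := hLb x y
      _ ≤ _ := by
          refine mul_le_mul_of_nonneg_right ?_ h0
          linarith [le_max_right LD 0]

/-- **The union bound over seven bad events.** [folklore] -/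
theorem measure_le_of_forall_notMem {Ω : Type*} [MeasurableSpace Ω] (P : Measure Ω)
    {S1 S2 S3 S4 S5 S6 S7 D : Set Ω} {δ₈ δ' : ℝ}
    (h1 : P S1 ≤ ENNReal.ofReal δ₈) (h2 : P S2 ≤ ENNReal.ofReal δ₈) (h3 : P S3 ≤ ENNReal.ofReal δ₈)
    (h4 : P S4 ≤ ENNReal.ofReal δ₈) (h5 : P S5 ≤ ENNReal.ofReal δ₈) (h6 : P S6 ≤ ENNReal.ofReal δ₈) (h7 : P S7 = 0)
    (hδ' : 6 * δ₈ ≤ δ')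
    (hD : ∀ z, z ∉ S1 → z ∉ S2 → z ∉ S3 → z ∉ S4 → z ∉ S5 → z ∉ S6 → z ∉ S7 → z ∉ D) :
    P D ≤ ENNReal.ofReal δ' := by
  have hsub : D ⊆ S1 ∪ S2 ∪ S3 ∪ S4 ∪ S5 ∪ S6 ∪ S7 := by
    intro z hz
    by_contra hcon
    simp only [Set.mem_union, not_or] at hcon
    obtain ⟨⟨⟨⟨⟨⟨n1, n2⟩, n3⟩, n4⟩, n5⟩, n6⟩, n7⟩ := hcon
    exact hD z n1 n2 n3 n4 n5 n6 n7 hz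
  calc P D ≤ P (S1 ∪ S2 ∪ S3 ∪ S4 ∪ S5 ∪ S6 ∪ S7) := measure_mono hsub
    _ ≤ P (S1 ∪ S2 ∪ S3 ∪ S4 ∪ S5 ∪ S6) + P S7 := measure_union_le _ _
    _ ≤ P (S1 ∪ S2 ∪ S3 ∪ S4 ∪ S5) + P S6 + P S7 := by gcongr; exact measure_union_le _ _
    _ ≤ P (S1 ∪ S2 ∪ S3 ∪ S4) + P S5 + P S6 + P S7 := by gcongr; exact measure_union_le _ _
    _ ≤ P (S1 ∪ S2 ∪ S3) + P S4 + P S5 + P S6 + P S7 := by gcongr; exact measure_union_le _ _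
    _ ≤ P (S1 ∪ S2) + P S3 + P S4 + P S5 + P S6 + P S7 := by gcongr; exact measure_union_le _ _
    _ ≤ P S1 + P S2 + P S3 + P S4 + P S5 + P S6 + P S7 := by gcongr; exact measure_union_le _ _
    _ ≤ ENNReal.ofReal δ₈ + ENNReal.ofReal δ₈ + ENNReal.ofReal δ₈ + ENNReal.ofReal δ₈ + ENNReal.ofReal δ₈ +
        ENNReal.ofReal δ₈ + 0 := by
        gcongr
        exact h7.le
    _ = 6 * ENNReal.ofReal δ₈ := by rw [add_zero]; ring
    _ = ENNReal.ofReal (6 * δ₈) := by rw [ENNReal.ofReal_mul (by norm_num), ENNReal.ofReal_ofNat]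
    _ ≤ ENNReal.ofReal δ' := ENNReal.ofReal_le_ofReal hδ'

set_option maxHeartbeats 400000 in
/-- **THE PATHWISE STEP OF THE WEAK READOUT.** See the module docstring. [folklore] -/
theorem readout_pathwise {N : ℕ} {σ : ℝ} (hσ : 0 < σ) (hσ1 : σ ^ 3 ≤ 1)
    (Φ : HardSphereFlow (Torus.geometry (Fin 3)) (hsDiameter σ N) (N + 1))
    (hG : (Torus.geometry (Fin 3)).IsHardSphereRegular (hsDiameter σ N))
    {z : Config (N + 1) (Fin 3) T3} (hz : z ∈ Φ.good)
    {T : ℝ} {ρ θ : ℝ → T3 → ℝ} {u : ℝ → T3 → V3} (hE : IsHardSphereEulerSolution σ T ρ u θ)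
    {t Δ τ₁ : ℝ} (ht0 : 0 ≤ t) (hΔ : 0 < Δ) (hΔτ : t + Δ ≤ τ₁) (hτ₁T : τ₁ < T)
    {η₀ ηg ηg2 ηcap : ℝ} (hη₀ : 0 ≤ η₀) (hg12 : ηg < ηg2) (hη₀g : η₀ ≤ ηg / 2) (hcapg : ηcap ≤ ηg / 2)
    (hcap0 : 0 ≤ ηcap) (hguard : ∀ s ∈ Set.Ico 0 T, ∀ x, ρ s x * σ ^ 3 < η₀)
    {b : T3 → ℝ} (hbc : Continuous b) {L : ℝ} (hL0 : 0 < L) (hbC : ∀ x, |b x| ≤ L)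
    (hbLip : ∀ x y, |b x - b y| ≤ L * Torus.euclidDist x y) (hb1 : Torus.IsContDiff 1 b)
    (hbD : ∀ x, ‖Torus.fderiv b x‖ ≤ L)
    (hJ : ∀ k : Fin 3, Torus.IsContDiff 1 (fun x => b x • EuclideanSpace.single k (1 : ℝ)) ∧
      (∀ x, ‖Torus.fderiv (fun x => b x • EuclideanSpace.single k (1 : ℝ)) x‖ ≤ L) ∧
      (∀ x y, ‖b x • EuclideanSpace.single k (1 : ℝ) - b y • EuclideanSpace.single k (1 : ℝ)‖ ≤
        L * Torus.euclidDist x y))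
    {KE : ℝ} (hKE0 : 0 ≤ KE) (h1 : ((N : ℝ) + 1)⁻¹ * configEnergy (Φ.flow 0 z) ≤ KE)
    {r : ℝ} (hr : 0 < r) (hr2 : r ≤ 1 / 2) {ωr : ℝ} (hωr : 0 < ωr)
    (hmod : ∀ x y, Torus.euclidDist x y < r → |b x - b y| ≤ ωr)
    {η₁ : ℝ} (hη₁ : 0 < η₁)
    (h2 : (∫ s in Set.Icc t (t + Δ),
      ((∫ x, |empiricalDensityField (Φ.flow s z) (fun y => cone r y x) - ρ s x|)
      + (∫ x, ‖empiricalMomentumField (Φ.flow s z) (fun y => cone r y x) - ρ s x • u s x‖)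
      + ∫ x, |empiricalEnergyField (Φ.flow s z) (fun y => cone r y x) -
          totalEnergyDensity (ρ s x) (u s x) (θ s x)|)) ≤ η₁ * Δ)
    {M κ₁ : ℝ} (h3 : (∫ u' in t..(t + Δ), ((N : ℝ) + 1)⁻¹ *
      ∑ i : Fin (N + 1), Set.indicator {v : V3 | M < ‖v‖} (fun v => ‖v‖ ^ 3) ((Φ.flow u' z i).2)) ≤ κ₁)
    {Lv η₂ : ℝ}
    (h4 : hsDiameter σ N / (N + 1 : ℝ) *
      (∑ᶠ (s : ℝ) (_ : s ∈ collisionTimes (Torus.geometry (Fin 3)) (hsDiameter σ N) (fun s => Φ.flow s z) ∩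
        Set.Icc 0 τ₁), ∑ i : Fin (N + 1), ∑ j : Fin (N + 1),
        (if i ≠ j ∧ ‖(Torus.geometry (Fin 3)).sepVec (Φ.flow s z i).1 (Φ.flow s z j).1‖ = hsDiameter σ N then
          (if Lv < ‖(Φ.flow s z i).2‖ ^ 2 + ‖(Φ.flow s z j).2‖ ^ 2 then
            1 + ‖(Φ.flow s z i).2‖ ^ 2 + ‖(Φ.flow s z j).2‖ ^ 2 else 0) else 0)) ≤ η₂)
    {CY η₃ : ℝ} (hCY0 : 0 ≤ CY) (hCY : ∀ a ∈ Set.Icc 0 ηg2, |deriv hsExcessFreeEnergy a| ≤ CY)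
    (h5 : |hsDiameter σ N / (N + 1 : ℝ) *
      (∑ᶠ (s : ℝ) (_ : s ∈ collisionTimes (Torus.geometry (Fin 3)) (hsDiameter σ N) (fun s => Φ.flow s z) ∩
        Set.Icc 0 τ₁), ∑ i : Fin (N + 1), ∑ j : Fin (N + 1),
        (if i ≠ j ∧ ‖(Torus.geometry (Fin 3)).sepVec (Φ.flow s z i).1 (Φ.flow s z j).1‖ = hsDiameter σ N then
          max 0 (min 1 (min ((s - t + Δ) / Δ) ((t + 2 * Δ - s) / Δ))) *
            max 0 (min 1 ((ηg2 - σ ^ 3 * DensityCapNegative.mollDensity r (Φ.flow s z) (Φ.flow s z i).1) / (ηg2 - ηg)))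
          else 0)) -
      σ ^ 3 * ∫ s in Set.Icc (0 : ℝ) τ₁, ∫ x : T3,
        max 0 (min 1 (min ((s - t + Δ) / Δ) ((t + 2 * Δ - s) / Δ))) *
          max 0 (min 1 ((ηg2 - σ ^ 3 * DensityCapNegative.mollDensity r (Φ.flow s z) x) / (ηg2 - ηg))) *
          (3 / (2 * Real.pi) * deriv hsExcessFreeEnergy (σ ^ 3 * DensityCapNegative.mollDensity r (Φ.flow s z) x)) *
          ∫ p, cone r p.1.1 x * cone r p.2.1 x * (Real.pi * ‖p.1.2 - p.2.2‖)
            ∂((empiricalMeasure (Φ.flow s z)).prod (empiricalMeasure (Φ.flow s z)))| ≤ η₃)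
    (h6 : ∀ s ∈ Set.Icc 0 τ₁, ∀ x, DensityCapNegative.mollDensity r (Φ.flow s z) x ≤ ρ s x + ηcap)
    {eU : ℝ} (hUρ : ∀ s ∈ Set.Icc t (t + Δ), ∀ x, |ρ s x - ρ t x| ≤ eU)
    (hUm : ∀ s ∈ Set.Icc t (t + Δ), ∀ x, ‖ρ s x • u s x - ρ t x • u t x‖ ≤ eU)
    (hUe : ∀ s ∈ Set.Icc t (t + Δ), ∀ x,
      |totalEnergyDensity (ρ s x) (u s x) (θ s x) - totalEnergyDensity (ρ t x) (u t x) (θ t x)| ≤ eU)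
    {κ : ℝ} (s1 : L * (KE + 1) * Δ ≤ κ / 16) (s2 : 6 * L * (KE + 1) * Δ ≤ κ / 16)
    (s3 : L * (max M 0 + 1) * (KE + 1) * Δ ≤ κ / 16)
    (s4 : L * ((1 + max Lv 0) * (η₃ + σ ^ 3 * (3 * Δ * (3 / (2 * Real.pi) * CY) *
      (2 * Real.pi * (η₀ / σ ^ 3 + ηcap) * (1 / 2 + KE)))) + η₂) ≤ 3 * κ / 64)
    (s5 : ωr * (KE + 1) ≤ κ / 16) (s6 : L * η₁ ≤ κ / 32) (s7 : L * eU ≤ κ / 16) (s8 : L * κ₁ ≤ κ / 32) :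
    |empiricalDensityField (Φ.flow t z) b - ∫ x, b x * ρ t x| ≤ κ / 2 ∧
    ‖empiricalMomentumField (Φ.flow t z) b - ∫ x, (b x * ρ t x) • u t x‖ ≤ κ / 2 ∧
    |empiricalEnergyField (Φ.flow t z) b - ∫ x, b x * totalEnergyDensity (ρ t x) (u t x) (θ t x)| ≤ κ / 2 := by
  have hγ := Φ.isTrajectory z hz
  have hn : (0 : ℝ) < ((N + 1 : ℕ) : ℝ) := by positivity
  have hncast : ((N : ℝ) + 1) = ((N + 1 : ℕ) : ℝ) := by push_cast; ring
  have hΔT : t + Δ < T := by linarith only [hΔτ, hτ₁T]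
  have hEz : ((N + 1 : ℕ) : ℝ)⁻¹ * configEnergy z ≤ KE := by
    rwa [Φ.configEnergy_flow hz 0, hncast] at h1
  have hE0 : 0 ≤ ((N + 1 : ℕ) : ℝ)⁻¹ * configEnergy z := by unfold configEnergy; positivity
  -- the windowed collision functional on `(t, t + Δ]`
  have hW := kfac_windowQuad_le hσ hσ1 Φ hz ht0 hΔ hΔτ hτ₁T hη₀ hg12 hη₀g hcapg hcap0 hguard hKE0 hEz hr hr2
    h4 hCY0 hCY h5 h6
  -- one good instant
  obtain ⟨s₀, hs₀, hs₀err⟩ := exists_good_instant Φ hz hr hE ht0 hΔ hΔT hη₁ h2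
  have hts : t ≤ s₀ := hs₀.1
  have hs₀Δ : s₀ ≤ t + Δ := hs₀.2
  have hs₀T : s₀ ∈ Set.Ico 0 T := ⟨ht0.trans hts, by linarith only [hs₀Δ, hΔτ, hτ₁T]⟩
  have htT' : t ∈ Set.Ico 0 T := ⟨ht0, by linarith only [hΔ, hΔτ, hτ₁T]⟩
  have heρ0 : 0 ≤ ∫ x, |empiricalDensityField (Φ.flow s₀ z) (fun y => cone r y x) - ρ s₀ x| :=
    integral_nonneg fun x => abs_nonneg _
  have hem0 : 0 ≤ ∫ x, ‖empiricalMomentumField (Φ.flow s₀ z) (fun y => cone r y x) - ρ s₀ x • u s₀ x‖ :=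
    integral_nonneg fun x => norm_nonneg _
  have hee0 : 0 ≤ ∫ x, |empiricalEnergyField (Φ.flow s₀ z) (fun y => cone r y x) -
      totalEnergyDensity (ρ s₀ x) (u s₀ x) (θ s₀ x)| := integral_nonneg fun x => abs_nonneg _
  -- the window functional on `(t, s₀]`
  have hWs : hsDiameter σ N / ((N + 1 : ℕ) : ℝ) *
      collisionPairSum (Torus.geometry (Fin 3)) (hsDiameter σ N) (fun s => Φ.flow s z) (Set.Ioc t s₀)
        (fun s i j => 1 + ‖(Φ.flow s z i).2‖ ^ 2 + ‖(Φ.flow s z j).2‖ ^ 2) ≤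
      (1 + max Lv 0) * (η₃ + σ ^ 3 * (3 * Δ * (3 / (2 * Real.pi) * CY) *
        (2 * Real.pi * (η₀ / σ ^ 3 + ηcap) * (1 / 2 + KE)))) + η₂ := by
    rw [← hncast]
    exact le_trans (mul_le_mul_of_nonneg_left (collisionPairSum_quad_mono hγ (Set.Ioc_subset_Ioc_right hs₀Δ)
      (Set.Ioc_subset_Icc_self : Set.Ioc t (t + Δ) ⊆ Set.Icc t (t + Δ)))
      (div_nonneg (hsDiameter_pos hσ N).le (by positivity))) hW
  -- the Euler slices
  have hρs : Continuous (ρ s₀) := (hE.smooth_density.isSmooth_slice hs₀T).continuous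
  have hρt : Continuous (ρ t) := (hE.smooth_density.isSmooth_slice htT').continuous
  have hus : Continuous (u s₀) := (hE.smooth_velocity.isSmooth_slice hs₀T).continuous
  have hut : Continuous (u t) := (hE.smooth_velocity.isSmooth_slice htT').continuous
  have hθs : Continuous (θ s₀) := (hE.smooth_temperature.isSmooth_slice hs₀T).continuous
  have hθt : Continuous (θ t) := (hE.smooth_temperature.isSmooth_slice htT').continuous
  have hes : Continuous fun x => totalEnergyDensity (ρ s₀ x) (u s₀ x) (θ s₀ x) := by
    unfold totalEnergyDensity
    exact hρs.mul (((hus.norm.pow 2).div_const 2).add (continuous_const.mul hθs))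
  have het : Continuous fun x => totalEnergyDensity (ρ t x) (u t x) (θ t x) := by
    unfold totalEnergyDensity
    exact hρt.mul (((hut.norm.pow 2).div_const 2).add (continuous_const.mul hθt))
  -- the chains
  have cρ := density_chain Φ hz hbc hL0.le hbC hbLip hr hr2 hmod (s₀ := s₀) hρs hρt (hUρ s₀ hs₀)
  have cm := momentum_chain Φ hG hz hbc hL0.le hbC hJ hr hr2 hωr.le hmod hts
    (m := fun s x => ρ s x • u s x) (hρs.smul hus) (hρt.smul hut) (hUm s₀ hs₀)
  have ce := energy_chain Φ hG hz hbc hL0.le hbC hbLip hb1 hbD hr hr2 hmod hts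
    (e := fun s x => totalEnergyDensity (ρ s x) (u s x) (θ s x)) hes het (hUe s₀ hs₀)
  have ccub := cubic_window_le Φ hz M hts hs₀Δ
  -- bookkeeping of the tolerances
  have f1 : L * Real.sqrt (2 * (((N + 1 : ℕ) : ℝ)⁻¹ * configEnergy z)) * |t - s₀| ≤ κ / 16 := by
    have hsq : Real.sqrt (2 * (((N + 1 : ℕ) : ℝ)⁻¹ * configEnergy z)) ≤ KE + 1 := by
      have h := stub_readoutPathwise hE0
      linarith only [h, hEz]
    have habs : |t - s₀| ≤ Δ := by
      rw [abs_sub_comm, abs_of_nonneg (sub_nonneg.2 hts)]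
      linarith only [hs₀Δ]
    calc L * Real.sqrt (2 * (((N + 1 : ℕ) : ℝ)⁻¹ * configEnergy z)) * |t - s₀| ≤ L * (KE + 1) * Δ := by gcongr
      _ ≤ κ / 16 := s1
  have f2 : ωr * (1 / 2 + ((N + 1 : ℕ) : ℝ)⁻¹ * configEnergy z) ≤ κ / 16 :=
    (mul_le_mul_of_nonneg_left (by linarith only [hEz]) hωr.le).trans s5
  have f2' : ωr * (((N + 1 : ℕ) : ℝ)⁻¹ * configEnergy z) ≤ κ / 16 :=
    (mul_le_mul_of_nonneg_left (by linarith only [hEz]) hωr.le).trans s5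
  have f2'' : ωr ≤ κ / 16 := (le_mul_of_one_le_right hωr.le (by linarith only [hKE0])).trans s5
  have f5 : 3 * (L * (2 * (((N + 1 : ℕ) : ℝ)⁻¹ * configEnergy z)) * (s₀ - t)) ≤ κ / 16 := by
    have h : L * (2 * (((N + 1 : ℕ) : ℝ)⁻¹ * configEnergy z)) * (s₀ - t) ≤ L * (2 * KE) * Δ := by
      gcongr
      linarith only [hs₀Δ]
    have hLΔ : 0 ≤ L * Δ := by positivity
    have e : 3 * (L * (2 * KE) * Δ) = 6 * L * (KE + 1) * Δ - 6 * (L * Δ) := by ring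
    linarith only [h, hLΔ, e, s2]
  have f7 : L / 2 * (((N + 1 : ℕ) : ℝ)⁻¹ * ∫ u' in t..s₀, ∑ i, ‖(Φ.flow u' z i).2‖ ^ 3) ≤ κ / 16 + κ / 64 := by
    have hx : L * max M 0 * KE * Δ ≤ κ / 16 := by
      have h0 : 0 ≤ L * max M 0 * Δ := by positivity
      have h0' : 0 ≤ L * KE * Δ := by positivity
      have h0'' : 0 ≤ L * Δ := by positivity
      have e : L * (max M 0 + 1) * (KE + 1) * Δ =
          L * max M 0 * KE * Δ + L * max M 0 * Δ + L * KE * Δ + L * Δ := by ring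
      linarith only [s3, e, h0, h0', h0'']
    have hy : L * max M 0 * (((N + 1 : ℕ) : ℝ)⁻¹ * configEnergy z) * Δ ≤ L * max M 0 * KE * Δ := by gcongr
    have hz' : L / 2 * (∫ u' in t..(t + Δ), ((N : ℝ) + 1)⁻¹ *
        ∑ i : Fin (N + 1), Set.indicator {v : V3 | M < ‖v‖} (fun v => ‖v‖ ^ 3) ((Φ.flow u' z i).2)) ≤ L / 2 * κ₁ :=
      mul_le_mul_of_nonneg_left h3 (by positivity)
    have h : L / 2 * (2 * max M 0 * (((N + 1 : ℕ) : ℝ)⁻¹ * configEnergy z) * Δ +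
        ∫ u' in t..(t + Δ), ((N : ℝ) + 1)⁻¹ *
          ∑ i : Fin (N + 1), Set.indicator {v : V3 | M < ‖v‖} (fun v => ‖v‖ ^ 3) ((Φ.flow u' z i).2)) ≤
        κ / 16 + κ / 64 := by
      have e : L / 2 * (2 * max M 0 * (((N + 1 : ℕ) : ℝ)⁻¹ * configEnergy z) * Δ +
          ∫ u' in t..(t + Δ), ((N : ℝ) + 1)⁻¹ *
            ∑ i : Fin (N + 1), Set.indicator {v : V3 | M < ‖v‖} (fun v => ‖v‖ ^ 3) ((Φ.flow u' z i).2)) =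
          L * max M 0 * (((N + 1 : ℕ) : ℝ)⁻¹ * configEnergy z) * Δ +
            L / 2 * (∫ u' in t..(t + Δ), ((N : ℝ) + 1)⁻¹ *
              ∑ i : Fin (N + 1), Set.indicator {v : V3 | M < ‖v‖} (fun v => ‖v‖ ^ 3) ((Φ.flow u' z i).2)) := by
        ring
      linarith only [e, hy, hz', hx, s8]
    exact (mul_le_mul_of_nonneg_left ccub (by positivity)).trans h
  have f8 : L * (hsDiameter σ N / ((N + 1 : ℕ) : ℝ) *
      collisionPairSum (Torus.geometry (Fin 3)) (hsDiameter σ N) (fun s => Φ.flow s z) (Set.Ioc t s₀)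
        (fun s i j => 1 + ‖(Φ.flow s z i).2‖ ^ 2 + ‖(Φ.flow s z j).2‖ ^ 2)) ≤
      3 * κ / 64 := (mul_le_mul_of_nonneg_left hWs hL0.le).trans s4
  have hWL : 0 ≤ hsDiameter σ N / ((N + 1 : ℕ) : ℝ) *
      collisionPairSum (Torus.geometry (Fin 3)) (hsDiameter σ N) (fun s => Φ.flow s z) (Set.Ioc t s₀)
        (fun s i j => 1 + ‖(Φ.flow s z i).2‖ ^ 2 + ‖(Φ.flow s z j).2‖ ^ 2) :=
    mul_nonneg (div_nonneg (hsDiameter_pos hσ N).le hn.le) (collisionPairSum_quad_nonneg _ _ _)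
  refine ⟨?_, ?_, ?_⟩
  · -- density
    have h : L * (∫ x, |empiricalDensityField (Φ.flow s₀ z) (fun y => cone r y x) - ρ s₀ x|) ≤ κ / 16 := by
      have h' := mul_le_mul_of_nonneg_left
        (show (∫ x, |empiricalDensityField (Φ.flow s₀ z) (fun y => cone r y x) - ρ s₀ x|) ≤ 2 * η₁ by
          linarith only [hs₀err, hem0, hee0]) hL0.le
      linarith only [h', s6]
    linarith only [cρ, f1, f2'', h, s7, hωr]
  · -- momentum
    have hI : (fun x => (b x * ρ t x) • u t x) = fun x => b x • (ρ t x • u t x) := funext fun x => mul_smul _ _ _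
    rw [hI]
    have h : L * (∫ x, ‖empiricalMomentumField (Φ.flow s₀ z) (fun y => cone r y x) - ρ s₀ x • u s₀ x‖) ≤ κ / 16 := by
      have h' := mul_le_mul_of_nonneg_left
        (show (∫ x, ‖empiricalMomentumField (Φ.flow s₀ z) (fun y => cone r y x) - ρ s₀ x • u s₀ x‖) ≤ 2 * η₁ by
          linarith only [hs₀err, heρ0, hee0]) hL0.le
      linarith only [h', s6]
    linarith only [cm, f5, f8, f2, h, s7, hωr, f2'', hWL]
  · -- energy
    have h : L * (∫ x, |empiricalEnergyField (Φ.flow s₀ z) (fun y => cone r y x) -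
        totalEnergyDensity (ρ s₀ x) (u s₀ x) (θ s₀ x)|) ≤ κ / 16 := by
      have h' := mul_le_mul_of_nonneg_left
        (show (∫ x, |empiricalEnergyField (Φ.flow s₀ z) (fun y => cone r y x) -
          totalEnergyDensity (ρ s₀ x) (u s₀ x) (θ s₀ x)|) ≤ 2 * η₁ by linarith only [hs₀err, heρ0, hem0]) hL0.le
      linarith only [h', s6]
    linarith only [ce, f7, f8, f2', h, s7, hωr, f2'', hWL]

end Summit.AtomisticToContinuum.HydrodynamicLimit.Theorems.ChaosClosesEulerReadout

end
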